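import Summits.QuantumFields.YangMills.Theorems.BalabanUVNodesSpineReadingOfRecord13CoPHKComponentSizeBlocksFreshTowerFibreFaces
import Literature.MathematicalPhysics.QuantumFieldTheory.Balaban1983to89.Node00.Record12ResidualsSlots

/-!
# LOCATED-4: THE PER-HISTORY ONE-STEP FRESH LETTERS ARE DEGENERATE WHEREVER (T) HOLDS — at a pin with class-wise telescoping (live ∕ identity ∕ prefix-preserving), one
# instance of `…BlocksFreshTowerFibreFaces`' letter hFA with rate `< 1` whose charged cubes sit in the collar `Λ_m(π₀) ∩ Z̃_m^{∼4}(π₀)` forces `cw_m(π₀) = 0`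

Cell `pub-ymgap`, YM-PLAN Track A (HUMAN RULING D-0062; width push D-0149); seat `pub-ymgap-dag-n20-d` (R134 (a) N20 NE7b s3 = the U5d ∕ `crOfRecord₁₃` lineage, its declarer)
gen 38.  `--kind proof --supports stmt-QuantumFields-27366 --as helper` (K3⁸); COUNT-NEUTRAL; THEOREMS ONLY (0 `def`).  [III] = [Balaban1988Convergent]; [LF-II] = [Balaban1989LargeFieldII].
Companion of `…BlocksFreshTowerFibreFaces` (gen 37, p765437: the N20 size-reading face at the live-pinned CoPH record modulo the PER-HISTORY one-step fresh letters hFA ∕ hFB),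
`…BlocksFreshTowerT` (gen 37: (T) `classWeightOfDatum₉_telescoping_A_of_ppSelLive`), `Node00.StepWeightsOfRecord` (n02-b ∕ def-T: the index map `σOfRecord`, (3.5) ∕ (3.20) of
[III]) and `Node00.Record12ResidualsSlots` (RR: `wOfRecord_eq_zero_of_forall_ne`).

WHY (a located defect of this lineage's own letter (O), numbers not adjectives).  hFA charges a rate `ζ K j i < 1` to the event «the cube `c` lies in `Λ_{i−1}(π₀)` and in
`Λ_i(π)ᶜ`» for the one-step extensions `π` of the history `π₀`.  In def-T's index map of record the new small-field region of EVERY label `t = (P,Q,R,S)` satisfies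
`Λ_{k+1}(t) ⊆ Ω_{k+1}(t) ⊆ Λ_k ∩ (Z̃_k^{∼4})ᶜ ∩ (∪P)ᶜ` (`LambdaOfLabel_subset`, `OmegaOfLabel_subset_guard`; [III] p. 265: «B^{k+1}(P¹_{k+1}) = (P′^∼_{k+1})ᶜ ∩ (Z̃_k^{∼5})ᶜ»,
(3.5), (3.20)), where `Z̃_k^{∼4}` = the `𝐃_{k+1}`-cubes meeting `Z_k = Λ_kᶜ` plus four layers (`Ztilde4`).  So a cube of `Λ_k ∩ Z̃_k^{∼4}` — small at level `k`, within five
`𝐃_{k+1}`-cubes of the old large-field region — is evicted from `Λ_{k+1}` by the COLLAR, for every label, with no large-field event and no small factor anywhere in print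
([LF-II] (1.79) p. 383 pays `exp(−p₀(g_j))` per NEW large-field region only; the collar growth is what the surplus `κ_j(Z)` of (1.80)–(1.88) pp. 384–387 is spent on).  Sequences
outside the image of the index map weigh `0` (`wOfRecord_eq_zero_of_forall_ne`), hence (§1) their dressed slot and class weight at the next level vanish, for ANY selector.
Therefore (§3), wherever the class weights telescope class-wise ((T): `Σ_{π.init = π₀} cw_{m+1}(π) = cw_m(π₀)` — a THEOREM at the live pin, gen 37), the fresh-filtered fibre sum
of such an instance IS `cw_m(π₀)`, and the letter reads `cw_m(π₀) ≤ Z · cw_m(π₀)` with `Z < 1`: `cw_m(π₀) = 0`.  Consequence (§4, hFA verbatim): at the live-pinned record hFA is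
inhabited only by dressed towers in which EVERY level-`m` run-A history (`m + 1 ≤ j ≤ jcut K`, `ζ K j (m+1) < 1`) that admits a member `(y₀, B)` of the separated cover family and an
assignment with a block charged at level `m + 1` inside `Λ_m(π₀) ∩ Z̃_m^{∼4}(π₀)` is MASSLESS — in words: wherever the cover family can place a charged block in the collar of
a history's large-field region, that history carries no weight.  The gen-37 NET «N20's size
reading at the live pin = theorem modulo numerics + hFA ∕ hFB» is therefore VACUOUS as a road to NE7b; (1.89)'s currency is the R-road's ((0.3) `Z ↦ Z″`, components
satisfying (i)–(ii) removed after `K(Z)` quiet steps), not a per-history letter at a prefix-preserving pin.  Run B (hFB, `blockDownSet`) is analogous and not needed for this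
conclusion (hFA is a hypothesis of the face on its own).

WHAT IS HERE.  §1 `dressedSlotsOfDatum₉_succ_eq_zero_of_forall_ne`, `classWeightOfDatum₉_succ_eq_zero_of_forall_ne` (support of the dressed tower on the image of the
index map, any selector); §2 `LambdaOfLabel_subset_compl_Ztilde4`, `subset_compl_Λ_succ_of_subset_Ztilde4` (the collar is evicted label-independently); §3 ★★★
`classWeightOfDatum₉_eq_zero_of_collarFreshLetter` (generic Stage-9 tuple, one fibre, (T) displayed); §4 ★★★ `classWeightOfDatum₉_eq_zero_of_collarFreshLetter_A_of_ppSelLive`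
(run A at the live-pinned CoPH record, (T) and the sign discharged) and ★★★★ `classWeightOfDatum₉_eq_zero_of_fibreFreshLetters_A_of_collar` (hFA of p765437 VERBATIM).

HONEST FRAMING.  [bookkeeping] finite sums + set algebra on def-T's objects BY NAME; a NEGATIVE structural statement about THIS LINEAGE's hypothesis hFA, not about any printed
statement; nothing of Bałaban's asserted; NE7 ∕ NE7b ∕ NE7c NOT PRINTED for `d = 4` ∕ NOT proved; no `Provisos₁₃CoPH` inhabitant claimed (K0⁷ OPEN) — in particular no history
with `cw_m(π₀) ≠ 0` is exhibited, so this is a vacuity theorem, not a refutation; K3⁸ v7 untouched; N19 ∕ N20 ∕ N21 ∕ N27 NOT discharged; counts UNMOVED (typed 28∕28 · discharged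
8∕27); one finite four-torus programme at fixed `ε` — NOT ℝ⁴, NOT OS, NOT a mass gap, NOT the Clay problem.  No `def`, no `instance`, no `notation`, no `sorry`; no decl below
carries a cite tag.
-/

noncomputable section

open MeasureTheory
open scoped BigOperators
open Finset

namespace YMDAG.UVSplit

open Literature.MathematicalPhysics.QuantumFieldTheory.Balaban1983to89
open Literature.MathematicalPhysics.QuantumFieldTheory.Balaban1983to89.T4Continuum
open Literature.MathematicalPhysics.QuantumFieldTheory.Balaban1983to89.Node00
open Literature.MathematicalPhysics.QuantumFieldTheory.Balaban1983to89.B14.Eq218Concrete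
open Literature.MathematicalPhysics.QuantumFieldTheory.Balaban1983to89.B5Eq118OneStroke (iterBlockOf iterBlock)
open Literature.MathematicalPhysics.QuantumFieldTheory.Balaban1983to89.T4FiniteEpsInhabited
open Summit.QuantumFields.YangMills.BalabanUVNodes.N19MGFRoadLiveSelectorTower (dressedSlotsOfDatum₉_nonneg)

/-! ## §1 The dressed tower lives on the image of the index map (any selector) -/

section Support

variable {F : T4Family} {N : ℕ} [NeZero N]

open scoped Classical in
/-- ★ **ABSENT SEQUENCES CARRY THE ZERO DRESSED SLOT, FOR ANY SELECTOR.**  If no label `t = (P,Q,R,S)` of def-T's index map produces the length-`(k+1)` sequence `s′` from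
its prefix (`σOfRecord … s′.init t ≠ s′` for all `t`), then F3's dressed slot of the Stage-9 tuple `ϑ` at level `k + 1` vanishes at `s′` identically: the slot is the 𝐑-stepped
𝐓-step (`texpAOfRecordFrom_succ`), the 𝐑-step of record multiplies the pre-𝐑 slot by a ratio sum (`rstepOfSel_TexpA`), and the pre-𝐑 slot is the transport of the integrand
`w(s′)·χ_k·slot_k` with `w(s′) ≡ 0` (RR's `wOfRecord_eq_zero_of_forall_ne`). [bookkeeping] -/
theorem dressedSlotsOfDatum₉_succ_eq_zero_of_forall_ne (ϑ : Stage9Params F N) (D : FiniteEpsData F (SU N)) (g₀ : ℕ → ℝ) (os : List (ULoop F)) (t : ℝ)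
    (p : B12.RunParams) (g : ℕ → ℝ) (k : ℕ) (s' : SeqOfRecord F ϑ.ν ϑ.τ9.M g p.K (k + 1))
    (h : ∀ lb : LbOfRecord F ϑ.ν p g k, σOfRecord F ϑ.ν ϑ.τ9.M p g k s'.init lb ≠ s') (V : GaugeField (F.P p.K) (k + 1) (SU N)) :
    dressedSlotsOfDatum₉ F N ϑ D g₀ os t p g (k + 1) s' V = 0 := by
  -- the pre-𝐑 slot vanishes: transport of the zero integrand
  have htstep : tstepOfRecord F N ϑ.ν ϑ.τ9.M (wOfRecord₉ F N ϑ) p g k (dressedSlotsOfDatum₉ F N ϑ D g₀ os t p g k) s' V = 0 := by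
    rw [tstepOfRecord, texpASucc_apply]
    have hw : ∀ U, wOfRecord₉ F N ϑ p g k s' U V = 0 := fun U =>
      wOfRecord_eq_zero_of_forall_ne F N ϑ.ν ϑ.τ9.M ϑ.A₁ ϑ.ζ p g k s' h U V
    simp only [hw, zero_mul, integral_zero, mul_zero]
  -- the slot recursion of record and the 𝐑-step as a slot operation
  have hrec : dressedSlotsOfDatum₉ F N ϑ D g₀ os t p g (k + 1) =
      rstepSlotOfRecord F N ϑ.ν ϑ.τ9 ϑ.ppSel p g (k + 1)
        (tstepOfRecord F N ϑ.ν ϑ.τ9.M (wOfRecord₉ F N ϑ) p g k (dressedSlotsOfDatum₉ F N ϑ D g₀ os t p g k)) :=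
    texpAOfRecordFrom_succ F N ϑ.ν ϑ.τ9.M _ (wOfRecord₉ F N ϑ) (rstepSlotOfRecord F N ϑ.ν ϑ.τ9 ϑ.ppSel) p g k
  rw [hrec]
  change tstepOfRecord F N ϑ.ν ϑ.τ9.M (wOfRecord₉ F N ϑ) p g k (dressedSlotsOfDatum₉ F N ϑ D g₀ os t p g k) s' V * _ = 0
  rw [htstep, zero_mul]

open scoped Classical in
/-- ★ **… HENCE THEIR CLASS WEIGHT AT THE NEXT LEVEL IS `0`** (`∫ χ_{k+1}(s′)·0 = 0`), for any selector, datum, source. [bookkeeping] -/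
theorem classWeightOfDatum₉_succ_eq_zero_of_forall_ne (ϑ : Stage9Params F N) (D : FiniteEpsData F (SU N)) (g₀ : ℕ → ℝ) (os : List (ULoop F))
    (p : B12.RunParams) (g : ℕ → ℝ) (k : ℕ) (t : ℝ) (s' : SeqOfRecord F ϑ.ν ϑ.τ9.M g p.K (k + 1))
    (h : ∀ lb : LbOfRecord F ϑ.ν p g k, σOfRecord F ϑ.ν ϑ.τ9.M p g k s'.init lb ≠ s') :
    classWeightOfDatum₉ F N ϑ D g₀ os p g (k + 1) t s' = 0 := by
  unfold classWeightOfDatum₉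
  simp only [dressedSlotsOfDatum₉_succ_eq_zero_of_forall_ne ϑ D g₀ os t p g k s' h, mul_zero, integral_zero]

end Support

/-! ## §2 The collar `Λ_k ∩ Z̃_k^{∼4}` is evicted from `Λ_{k+1}` by every label -/

section Collar

variable (F : T4Family) (ν : Stage7Numerics) (M : ℕ) (p : B12.RunParams) (g : ℕ → ℝ) (k : ℕ)

/-- ★ **`Λ_{k+1}(t) ⊆ (Z̃_k^{∼4})ᶜ` FOR EVERY LABEL `t`**: def-T's `Λ_{k+1}(t) ⊆ Ω_{k+1}(t)` (`LambdaOfLabel_subset`), `Ω_{k+1}(t) ⊆ guardΩ = Λ_k ∩ (Z̃_k^{∼4})ᶜ ∩ (∪P)ᶜ`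
(`OmegaOfLabel_subset_guard`; [III] (3.5) p. 265, `B^{k+1}(P¹) ⊆ (Z̃_k^{∼5})ᶜ`). [bookkeeping] -/
theorem LambdaOfLabel_subset_compl_Ztilde4 (s : SeqOfRecord F ν M g p.K k) (t : LbOfRecord F ν p g k) :
    LambdaOfLabel F ν M p g k s t ⊆ (Ztilde4 F ν M p g k s)ᶜ := by
  intro x hx
  have hg := OmegaOfLabel_subset_guard F ν M p g k s t (LambdaOfLabel_subset F ν M p g k s t hx)
  exact hg.1.2

/-- ★ **A SET INSIDE `Z̃_k^{∼4}(s)` MISSES `Λ_{k+1}` OF EVERY PRESENT ONE-STEP EXTENSION OF `s`**: if `s′ = σOfRecord … s t` for some label `t`, then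
`c ⊆ Z̃_k^{∼4}(s)` gives `c ⊆ (s′.Λ (k+1))ᶜ` — the «fresh exit» of `c` happens for every label, large field or not. [bookkeeping] -/
theorem subset_compl_Λ_succ_of_subset_Ztilde4 (s : SeqOfRecord F ν M g p.K k) {c : Set (Site (F.P p.K) 0)} (hc : c ⊆ Ztilde4 F ν M p g k s)
    (s' : SeqOfRecord F ν M g p.K (k + 1)) (t : LbOfRecord F ν p g k) (ht : σOfRecord F ν M p g k s t = s') :
    c ⊆ (s'.Λ (k + 1))ᶜ := by
  intro x hx hxΛ
  rw [← ht, σOfRecord_Λ_succ] at hxΛ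
  exact LambdaOfLabel_subset_compl_Ztilde4 F ν M p g k s t hxΛ (hc hx)

end Collar

/-! ## §3 The vacuity at one fibre: (T) + a collar-positioned fresh letter with rate `< 1` ⇒ the history is massless -/

section Vacuity

variable {F : T4Family} {N : ℕ} [NeZero N]

open scoped Classical in
/-- ★★★ **A COLLAR-POSITIONED PER-HISTORY FRESH LETTER WITH RATE `< 1` ANNIHILATES THE HISTORY, WHEREVER (T) HOLDS.**  Generic Stage-9 tuple `ϑ`, datum `D`, run `p`,
couplings `g`, source `t`, level `m`, history `π₀`; a finite family of blocks `B` with levels `lvl` and cubes `cube` (point sets of the fine torus).  GIVEN (T) at the fibre of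
`π₀` (`Σ_{s′.init = π₀} cw_{m+1}(s′) = cw_m(π₀)`), `0 ≤ cw_m(π₀)`, ONE instance of the per-history fresh letter «`Σ_{π : π.init = π₀, every block x with lvl x = m+1 has cube x ⊆
(π.Λ (lvl x))ᶜ} cw_{m+1}(π) ≤ Z · cw_m(π₀)`» with `Z < 1`, and the COLLAR POSITION «every block charged at level `m + 1` has `cube x ⊆ Z̃_m^{∼4}(π₀)`»: then `cw_m(π₀) = 0`.
Proof: a sequence of the fibre failing the fresh clause is absent from the image of the index map (§2), hence weighs `0` (§1); so the fresh-filtered fibre sum is the whole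
fibre sum `= cw_m(π₀)` by (T), and `cw_m(π₀) ≤ Z·cw_m(π₀)` with `Z < 1`, `cw_m(π₀) ≥ 0`. [bookkeeping] -/
theorem classWeightOfDatum₉_eq_zero_of_collarFreshLetter (ϑ : Stage9Params F N) (D : FiniteEpsData F (SU N)) (g₀ : ℕ → ℝ) (os : List (ULoop F))
    (p : B12.RunParams) (g : ℕ → ℝ) (m : ℕ) (t : ℝ) (π₀ : SeqOfRecord F ϑ.ν ϑ.τ9.M g p.K m)
    {ι : Type*} (B : Finset ι) (lvl : ι → ℕ) (cube : ι → Set (Site (F.P p.K) 0)) {Z : ℝ}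
    (hT : ∑ s' ∈ Finset.univ.filter (fun s' : SeqOfRecord F ϑ.ν ϑ.τ9.M g p.K (m + 1) => s'.init = π₀),
        classWeightOfDatum₉ F N ϑ D g₀ os p g (m + 1) t s' = classWeightOfDatum₉ F N ϑ D g₀ os p g m t π₀)
    (hcw0 : 0 ≤ classWeightOfDatum₉ F N ϑ D g₀ os p g m t π₀)
    (hletter : ∑ π ∈ Finset.univ.filter (fun π : SeqOfRecord F ϑ.ν ϑ.τ9.M g p.K (m + 1) =>
        π.init = π₀ ∧ ∀ x ∈ B, lvl x = m + 1 → cube x ⊆ (π.Λ (lvl x))ᶜ),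
        classWeightOfDatum₉ F N ϑ D g₀ os p g (m + 1) t π ≤ Z * classWeightOfDatum₉ F N ϑ D g₀ os p g m t π₀)
    (hZ : Z < 1) (hcollar : ∀ x ∈ B, lvl x = m + 1 → cube x ⊆ Ztilde4 F ϑ.ν ϑ.τ9.M p g m π₀) :
    classWeightOfDatum₉ F N ϑ D g₀ os p g m t π₀ = 0 := by
  set cw := classWeightOfDatum₉ F N ϑ D g₀ os p g m t π₀ with hcw
  -- a sequence of the fibre failing the fresh clause is absent, hence weighs 0
  have hzero : ∀ s' ∈ Finset.univ.filter (fun s' : SeqOfRecord F ϑ.ν ϑ.τ9.M g p.K (m + 1) => s'.init = π₀),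
      ¬ (s'.init = π₀ ∧ ∀ x ∈ B, lvl x = m + 1 → cube x ⊆ (s'.Λ (lvl x))ᶜ) →
      classWeightOfDatum₉ F N ϑ D g₀ os p g (m + 1) t s' = 0 := by
    intro s' hs' hnot
    have hinit : s'.init = π₀ := (Finset.mem_filter.1 hs').2
    apply classWeightOfDatum₉_succ_eq_zero_of_forall_ne ϑ D g₀ os p g m t s'
    intro lb hlb
    apply hnot
    refine ⟨hinit, fun x hx hl => ?_⟩
    rw [hl]
    rw [hinit] at hlb
    exact subset_compl_Λ_succ_of_subset_Ztilde4 F ϑ.ν ϑ.τ9.M p g m π₀ (hcollar x hx hl) s' lb hlb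
  -- so the fresh-filtered fibre sum is the whole fibre sum
  have hsplit : ∑ π ∈ Finset.univ.filter (fun π : SeqOfRecord F ϑ.ν ϑ.τ9.M g p.K (m + 1) =>
        π.init = π₀ ∧ ∀ x ∈ B, lvl x = m + 1 → cube x ⊆ (π.Λ (lvl x))ᶜ),
        classWeightOfDatum₉ F N ϑ D g₀ os p g (m + 1) t π =
      ∑ s' ∈ Finset.univ.filter (fun s' : SeqOfRecord F ϑ.ν ϑ.τ9.M g p.K (m + 1) => s'.init = π₀),
        classWeightOfDatum₉ F N ϑ D g₀ os p g (m + 1) t s' := by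
    rw [← Finset.sum_filter_add_sum_filter_not (Finset.univ.filter (fun s' : SeqOfRecord F ϑ.ν ϑ.τ9.M g p.K (m + 1) => s'.init = π₀))
      (fun s' => s'.init = π₀ ∧ ∀ x ∈ B, lvl x = m + 1 → cube x ⊆ (s'.Λ (lvl x))ᶜ)]
    rw [Finset.sum_eq_zero (s := (Finset.univ.filter (fun s' : SeqOfRecord F ϑ.ν ϑ.τ9.M g p.K (m + 1) => s'.init = π₀)).filter
      (fun s' => ¬ (s'.init = π₀ ∧ ∀ x ∈ B, lvl x = m + 1 → cube x ⊆ (s'.Λ (lvl x))ᶜ)))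
      (fun s' hs' => hzero s' (Finset.mem_filter.1 hs').1 (Finset.mem_filter.1 hs').2), add_zero]
    refine Finset.sum_congr ?_ (fun _ _ => rfl)
    ext s'
    simp only [Finset.mem_filter, Finset.mem_univ, true_and]
    exact ⟨fun h => ⟨h.1, h⟩, fun h => h.2⟩
  have hle : cw ≤ Z * cw := by
    have h := hletter
    rw [hsplit, hT] at h
    exact h
  exact le_antisymm (by nlinarith [hle, hcw0, hZ]) hcw0

end Vacuity

/-! ## §4 Run A at the live-pinned CoPH record: (T) and the sign discharged; hFA verbatim -/

section Record

variable {F : T4Family} {N : ℕ} [NeZero N]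
variable (θ : Stage13HParams F N) (hP : θ.Provisos₁₃CoPH F N) (K₀ : ℕ) (g₀ : ℕ → ℝ) (os : List (ULoop F))

open scoped Classical in
/-- ★★★ **THE VACUITY FOR RUN A AT THE LIVE-PINNED CoPH RECORD.**  GIVEN the live pin `hsel`, (H-U) and `0 ≤ θ.ζ` — under which (T) is gen 37's theorem
`classWeightOfDatum₉_telescoping_A_of_ppSelLive` and the class weights are non-negative —, a level `m < K₀ + K`, a source `t`, a history `π₀` of run A, and ONE instance of a
per-history fresh letter at `(m, π₀)` with rate `Z < 1` whose blocks charged at level `m + 1` all lie in `Z̃_m^{∼4}(π₀)`: `cw^A_m(π₀) = 0`. [bookkeeping] -/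
theorem classWeightOfDatum₉_eq_zero_of_collarFreshLetter_A_of_ppSelLive
    (hsel : θ.ppSel = ppSelLiveOfRecord F N θ.ν θ.τ9 (EOfRecord₁₃ F N θ.toStage13Params) (wOfRecord₉ F N θ.toStage9Params))
    (hU : LocalBgMeasurable F N θ.ν) (hζsign : ∀ p g k s Pl Ql RS U V', 0 ≤ θ.ζ p g k s Pl Ql RS U V')
    (K : ℕ) (t : ℝ) (m : ℕ) (hm : m < K₀ + K) (π₀ : SeqOfRecord F θ.ν θ.τ9.M (histA₁₃ θ K₀ g₀ K) (K₀ + K) m)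
    {ι : Type*} (B : Finset ι) (lvl : ι → ℕ) (cube : ι → Set (Site (F.P (K₀ + K)) 0)) {Z : ℝ}
    (hletter : ∑ π ∈ Finset.univ.filter (fun π : SeqOfRecord F θ.ν θ.τ9.M (histA₁₃ θ K₀ g₀ K) (K₀ + K) (m + 1) =>
        π.init = π₀ ∧ ∀ x ∈ B, lvl x = m + 1 → cube x ⊆ (π.Λ (lvl x))ᶜ),
        classWeightOfDatum₉ F N θ.toStage9Params (datumOfRecord₁₃CoPH F N θ hP) g₀ os (runA₁₃ F K₀ g₀ K) (histA₁₃ θ K₀ g₀ K) (m + 1) t π ≤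
      Z * classWeightOfDatum₉ F N θ.toStage9Params (datumOfRecord₁₃CoPH F N θ hP) g₀ os (runA₁₃ F K₀ g₀ K) (histA₁₃ θ K₀ g₀ K) m t π₀)
    (hZ : Z < 1) (hcollar : ∀ x ∈ B, lvl x = m + 1 → cube x ⊆ Ztilde4 F θ.ν θ.τ9.M (runA₁₃ F K₀ g₀ K) (histA₁₃ θ K₀ g₀ K) m π₀) :
    classWeightOfDatum₉ F N θ.toStage9Params (datumOfRecord₁₃CoPH F N θ hP) g₀ os (runA₁₃ F K₀ g₀ K) (histA₁₃ θ K₀ g₀ K) m t π₀ = 0 := by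
  have hw0 : ∀ (p : B12.RunParams) (g : ℕ → ℝ) k s' U V', 0 ≤ wOfRecord₉ F N θ.toStage9Params p g k s' U V' := fun p g k s' U V' =>
    wOfRecord_nonneg F N θ.ν θ.τ9.M p g k θ.A₁ hζsign s' U V'
  have hcw0 : 0 ≤ classWeightOfDatum₉ F N θ.toStage9Params (datumOfRecord₁₃CoPH F N θ hP) g₀ os (runA₁₃ F K₀ g₀ K) (histA₁₃ θ K₀ g₀ K) m t π₀ :=
    integral_nonneg fun V => mul_nonneg (chiSeqOfRecord_nonneg F N θ.ν θ.τ9.M (histA₁₃ θ K₀ g₀ K) (runA₁₃ F K₀ g₀ K).K m π₀ V)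
      (dressedSlotsOfDatum₉_nonneg F N θ.toStage9Params (datumOfRecord₁₃CoPH F N θ hP) g₀ os (runA₁₃ F K₀ g₀ K) (histA₁₃ θ K₀ g₀ K)
        (hw0 (runA₁₃ F K₀ g₀ K) (histA₁₃ θ K₀ g₀ K)) t m π₀ V)
  exact classWeightOfDatum₉_eq_zero_of_collarFreshLetter θ.toStage9Params (datumOfRecord₁₃CoPH F N θ hP) g₀ os (runA₁₃ F K₀ g₀ K) (histA₁₃ θ K₀ g₀ K) m t π₀
    B lvl cube (classWeightOfDatum₉_telescoping_A_of_ppSelLive θ hP K₀ g₀ os hsel hU hζsign K t m hm π₀) hcw0 hletter hZ hcollar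

open scoped Classical in
/-- ★★★★ **hFA OF `…BlocksFreshTowerFibreFaces` (p765437), VERBATIM, IS INHABITED ONLY BY TOWERS WITHOUT COLLARED LARGE FIELDS.**  GIVEN the live pin, (H-U), `0 ≤ θ.ζ`,
`jcut K ≤ K₀ + K`, non-negative rates `ζ`, and hFA: for every step `K`, source `|t| ≤ 1`, level `j ∈ [1, jcut K]`, member `p = (y₀, B)` of the separated cover family, assignment
`a`, every `m` with `m + 1 ≤ j` and `ζ K j (m+1) < 1`, and every level-`m` run-A history `π₀` such that `a` charges AT LEAST ONE block at level `m + 1` and every block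
charged at level `m + 1` has its cube inside `Λ_m(π₀) ∩ Z̃_m^{∼4}(π₀)` (small at level `m`, within the four-layer collar of the old large-field region; at `m = 0` there is no
old region, `Z̃_0^{∼4} = ∅`, and the hypothesis is void): `cw^A_m(π₀) = 0`.  The decidability instances hidden in hFA's filter are matched by `convert` (subsingletons).
[bookkeeping] -/
theorem classWeightOfDatum₉_eq_zero_of_fibreFreshLetters_A_of_collar (jcut : ℕ → ℕ) (ϱ k lv : ℕ → ℕ → ℕ)
    (hsel : θ.ppSel = ppSelLiveOfRecord F N θ.ν θ.τ9 (EOfRecord₁₃ F N θ.toStage13Params) (wOfRecord₉ F N θ.toStage9Params))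
    (hU : LocalBgMeasurable F N θ.ν) (hζsign : ∀ p g k s Pl Ql RS U V', 0 ≤ θ.ζ p g k s Pl Ql RS U V')
    (hjcut : ∀ K, jcut K ≤ K₀ + K) {ζ : ℕ → ℕ → ℕ → ℝ} (hζ0 : ∀ K j i, 0 ≤ ζ K j i)
    (hFA : ∀ (K : ℕ) (t : ℝ), |t| ≤ 1 → ∀ j ∈ Finset.Icc 1 (jcut K),
      ∀ p ∈ sepAnimalCoverFamily (SiteTouch (P := F.P (K₀ + K)) (j := lv K j)) (SupNear (P := F.P (K₀ + K)) (j := lv K j) (ϱ K j)) (k K j),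
      ∀ a ∈ p.2.pi (fun b => (Finset.Icc 1 j).sigma fun i => Finset.univ.filter (fun c : Site (F.P (K₀ + K)) (lv K i) =>
        (↑(iterBlock (lv K i) c) : Set (Site (F.P (K₀ + K)) 0)) ⊆ ↑(iterBlock (lv K j) b))),
      ∀ m, m + 1 ≤ j → ∀ π₀ : SeqOfRecord F θ.ν θ.τ9.M (histA₁₃ θ K₀ g₀ K) (K₀ + K) m,
      (∀ x ∈ p.2.attach, (a x.1 x.2).1 = m + 1 → 2 ≤ (a x.1 x.2).1 →
        (↑(iterBlock (lv K (a x.1 x.2).1) (a x.1 x.2).2) : Set (Site (F.P (K₀ + K)) 0)) ⊆ π₀.Λ ((a x.1 x.2).1 - 1)) →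
      ∑ π ∈ Finset.univ.filter (fun π : SeqOfRecord F θ.ν θ.τ9.M (histA₁₃ θ K₀ g₀ K) (K₀ + K) (m + 1) =>
          π.init = π₀ ∧ ∀ x ∈ p.2.attach, (a x.1 x.2).1 = m + 1 →
            (↑(iterBlock (lv K (a x.1 x.2).1) (a x.1 x.2).2) : Set (Site (F.P (K₀ + K)) 0)) ⊆ (π.Λ (a x.1 x.2).1)ᶜ),
        classWeightOfDatum₉ F N θ.toStage9Params (datumOfRecord₁₃CoPH F N θ hP) g₀ os (runA₁₃ F K₀ g₀ K) (histA₁₃ θ K₀ g₀ K) (m + 1) t π ≤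
      (∏ x ∈ p.2.attach.filter (fun x => (a x.1 x.2).1 = m + 1), ζ K j (a x.1 x.2).1) *
        classWeightOfDatum₉ F N θ.toStage9Params (datumOfRecord₁₃CoPH F N θ hP) g₀ os (runA₁₃ F K₀ g₀ K) (histA₁₃ θ K₀ g₀ K) m t π₀)
    (K : ℕ) (t : ℝ) (ht : |t| ≤ 1) (j : ℕ) (hj : j ∈ Finset.Icc 1 (jcut K))
    (p : Site (F.P (K₀ + K)) (lv K j) × Finset (Site (F.P (K₀ + K)) (lv K j)))
    (hp : p ∈ sepAnimalCoverFamily (SiteTouch (P := F.P (K₀ + K)) (j := lv K j)) (SupNear (P := F.P (K₀ + K)) (j := lv K j) (ϱ K j)) (k K j))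
    (a : (b : Site (F.P (K₀ + K)) (lv K j)) → b ∈ p.2 → (i : ℕ) × Site (F.P (K₀ + K)) (lv K i))
    (ha : a ∈ p.2.pi (fun b => (Finset.Icc 1 j).sigma fun i => Finset.univ.filter (fun c : Site (F.P (K₀ + K)) (lv K i) =>
        (↑(iterBlock (lv K i) c) : Set (Site (F.P (K₀ + K)) 0)) ⊆ ↑(iterBlock (lv K j) b))))
    (m : ℕ) (hmj : m + 1 ≤ j) (hζ1 : ζ K j (m + 1) < 1)
    (π₀ : SeqOfRecord F θ.ν θ.τ9.M (histA₁₃ θ K₀ g₀ K) (K₀ + K) m)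
    (hcharged : ∃ x ∈ p.2.attach, (a x.1 x.2).1 = m + 1)
    (hcollar : ∀ x ∈ p.2.attach, (a x.1 x.2).1 = m + 1 →
      (↑(iterBlock (lv K (a x.1 x.2).1) (a x.1 x.2).2) : Set (Site (F.P (K₀ + K)) 0)) ⊆
        π₀.Λ m ∩ Ztilde4 F θ.ν θ.τ9.M (runA₁₃ F K₀ g₀ K) (histA₁₃ θ K₀ g₀ K) m π₀) :
    classWeightOfDatum₉ F N θ.toStage9Params (datumOfRecord₁₃CoPH F N θ hP) g₀ os (runA₁₃ F K₀ g₀ K) (histA₁₃ θ K₀ g₀ K) m t π₀ = 0 := by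
  have hjK : j ≤ K₀ + K := (Finset.mem_Icc.1 hj).2.trans (hjcut K)
  have hmK : m < K₀ + K := by omega
  -- the small-at-level-`m` side condition of hFA, from the collar position
  have hside : ∀ x ∈ p.2.attach, (a x.1 x.2).1 = m + 1 → 2 ≤ (a x.1 x.2).1 →
      (↑(iterBlock (lv K (a x.1 x.2).1) (a x.1 x.2).2) : Set (Site (F.P (K₀ + K)) 0)) ⊆ π₀.Λ ((a x.1 x.2).1 - 1) := by
    intro x hx hl _
    have hΛ : π₀.Λ ((a x.1 x.2).1 - 1) = π₀.Λ m := by rw [hl, Nat.add_sub_cancel]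
    rw [hΛ]
    exact (hcollar x hx hl).trans Set.inter_subset_left
  have hletter := hFA K t ht j hj p hp a ha m hmj π₀ hside
  -- the rate: `Π_{x : i_x = m+1} ζ K j i_x = ζ K j (m+1) ^ #charged < 1`
  have hprod : (∏ x ∈ p.2.attach.filter (fun x => (a x.1 x.2).1 = m + 1), ζ K j (a x.1 x.2).1) =
      ζ K j (m + 1) ^ (p.2.attach.filter (fun x => (a x.1 x.2).1 = m + 1)).card := by
    rw [← Finset.prod_const]
    exact Finset.prod_congr rfl fun x hx => by rw [(Finset.mem_filter.1 hx).2]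
  have hcard : (p.2.attach.filter (fun x => (a x.1 x.2).1 = m + 1)).card ≠ 0 := by
    rw [Finset.card_ne_zero]
    obtain ⟨x, hx, hl⟩ := hcharged
    exact ⟨x, Finset.mem_filter.2 ⟨hx, hl⟩⟩
  have hZ : (∏ x ∈ p.2.attach.filter (fun x => (a x.1 x.2).1 = m + 1), ζ K j (a x.1 x.2).1) < 1 := by
    rw [hprod]
    exact pow_lt_one₀ (hζ0 K j (m + 1)) hζ1 hcard
  refine classWeightOfDatum₉_eq_zero_of_collarFreshLetter_A_of_ppSelLive θ hP K₀ g₀ os hsel hU hζsign K t m hmK π₀ p.2.attach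
    (fun x => (a x.1 x.2).1) (fun x => (↑(iterBlock (lv K (a x.1 x.2).1) (a x.1 x.2).2) : Set (Site (F.P (K₀ + K)) 0))) ?_ hZ ?_
  · convert hletter using 3
  · exact fun x hx hl => (hcollar x hx hl).trans Set.inter_subset_right

end Record

end YMDAG.UVSplit

end
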